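/-
Copyright (c) 2026 the pub-hodgecm-mathlib formalisation cell (harness21).  Prover seat hodgecm-mathlib-K2E3-p21 (g7), HCML Track B «K2-LIT» ∕ h413
(`stmt-HodgeConjecture-24833`), line `K2_E3_EllipticInputs`, leaf (nsc-S-A′), brick (E4b) = discharge of `h3cell` of ★ E4a, part (E4b-1β) MIDDLE CELL (dealer D107), file 2:
the `GL₂`-equivariant middle-cell map `Ψ₁ : J₁ → I₂(χ₂)` with its value formula (consumer letter L1 of K2E3-p03 (E4b-3), bus 2026-09-04 12:12Z; architect K2E3-p25 (g2)).
-/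
import Summits.HodgeConjecture.HodgeConjecture.Theorems.K2E3GL3BorelInducedJacquetQMiddleCellIntegrand   -- ★ file 1 (this seat, p860169): the integrand and its symmetries
import Summits.HodgeConjecture.HodgeConjecture.Theorems.K2E3GL3BorelInducedJacquetQClosedCellGL2      -- ★ (E4b-1α′) (p14, p860082): `blockDiagonalGL_iota_mem_borel ∕ _mem_upperUnitriangular`, `blockDiagonalGL_apply_block`
import Summits.HodgeConjecture.HodgeConjecture.Theorems.K2E3GL3PrincipalSeriesExponents              -- ★ H0-a (p25 g0): `det_fin_one_block`
import Summits.HodgeConjecture.HodgeConjecture.Theorems.K2E3GL2UnlinkedIrreducible                  -- ★ GL2-UNL (p11): `coe_unramifiedTwist_one` (+ ★ `unramifiedTwist`)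
import Literature.NumberTheory.Automorphic.SmoothIndOpenCellHaarFunctional                          -- ★ `apply_eq_zero_of_mk_coinvariants_eq_zero`
import HarnessLib

/-!
# K2_E3 road (h413), leaf (nsc-S-A′), brick (E4b-1β) file 2 — THE MIDDLE `(B, P_{(2,1)})`-CELL MAP `Ψ₁ : J₁ → I₂(χ₂)`,
# `Ψ₁[f](g) = ∫_F f(s₂ · x₁₂(y) · diag(ι g)) dy`, `GL₂`-EQUIVARIANT, ON THE CLASSES OF FUNCTIONS VANISHING ON `P`

Cell `pub/hodgecm-mathlib` (D-0151), Track B, seat K2E3-p21 (g7).  `--supports stmt-HodgeConjecture-24833 --as helper`; THEOREMS ONLY (no definition ∕ instance ∕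
notation ∕ `sorry`); never imports `Cruxes/…/Lines`.  COUNT-NEUTRAL.  Currency of the letters L0∕L1∕L2 of E4b-3 (K2E3-p03, 12:12Z): `c = ![0,0,1]`, `B₃`, `σ′` the inducing
character of `χ : T₃ →* ℂˣ` (`I χ = smoothIndRep B₃ σ′ = parabolicIndGL F id (𝟙.twist χ)` by `rfl`), `V = (restrictUnipotentGL F c (I χ)).Coinvariants`, `J = jacquetGL F c (I χ)`,
`mk = Coinvariants.mk _`, `P = ↑(standardParabolicGL F c)`, `I₂ χ₂` on `SmoothInd B₂ (twist ((𝟙.twist χ₂).comp levi₂) δ_{B₂}^{1∕2})`, a block embedding `ι : GL₂(F) →* M_c` with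
`diag(ι g) = [[g,0],[0,1]]` (`hι`) and `Continuous ι`.

THE MATHEMATICS ([BernsteinZelevinsky1977, Thm. 5.2, middle orbit]; [Casselman1995, §6.3]).  With ★ file 1 (the integrand `y ↦ f(s₂ x₁₂(y) g)`, its compact support on
`X¹ = vanishingOn P`, its `U_P`-invariance and torus substitution):
* §1 **the Borel multiplier**: a character `C : B₃ →* ℂˣ`, trivial on `U₃`, with `∫ f(s₂x₁₂(y)·βg) dy = C(β)·∫ f(s₂x₁₂(y)·g) dy` for all `β ∈ B₃` —
  `C(β) = σ′(s₂ t s₂⁻¹)·‖t₁₁∕t₂₂‖` for the diagonal part `t` of `β` (torus substitution of ★ file 1, then its unipotent shift);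
* §2 **the block character `χ₂`** of the diagonal torus of `GL₂`: `∫ f(s₂x₁₂(y)·diag(ι b)·g) dy = τ_{χ₂}(b)·∫ f(s₂x₁₂(y)·g) dy` on `B₂`, `τ_{χ₂} = (χ₂∘levi₂)·δ_{B₂}^{1∕2}`
  (`χ₂ = (C∘κ∘emb₂)·(δ_{B₂}^{1∕2}∘emb₂)⁻¹`, `κ b = diag(ι b) ∈ B₃` — the device of ★ 1α′ `exists_blockChar_inducingChar_eq` with `Ad(s₂)` and the modulus thrown in);
  in the letters of H0: `χ₂ = (χ₀ν^{1∕2}) ⊠ (χ₂ν^{1∕2})` for `χ = tch ![χ₀,χ₁,χ₂]` (not needed downstream, hidden under `∃`);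
* §3 **the map**: `f ↦ (g ↦ ∫ f(s₂x₁₂(y)·diag(ι g)) dy)` is a linear map `X¹ → I₂(χ₂)` (left `B₂`-equivariance §2; smooth along the stabiliser of `f` pulled back by `diag ∘ ι`),
  `U_P`-invariant (★ file 1), hence — `U_P` being a limit of compact open subgroups, ★ `apply_eq_zero_of_mk_coinvariants_eq_zero` — it kills the functions with zero class and
  DESCENDS to `J₁ = [X¹]` (∃-membership form of ★ 1α): **`exists_middleCellMap_formula`** gives `χ₂` and `Ψ : J₁.toSubmodule →ₗ[ℂ] I₂(χ₂)` with the VALUE FORMULA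
  `(Ψ [f]).toFun g = ∫ f(s₂x₁₂(y)·diag(ι g)) dμ` and the EQUIVARIANCE `Ψ (J₁.toRepresentation (ι g) a) = I₂ χ₂ g (Ψ a)` — letter L1 of E4b-3 except for its kernel clause,
  which is file 3 `K2E3GL3BorelInducedJacquetQMiddleCellKernel` (★ (E4b-τ) averaging tools of K2E3-p14).
Any additive Haar measure `μ` on `F` and any coordinate map `e` (★ `exists_coordHomeomorph`) may be used; the letter's `∃` hides them.

HONEST LABEL: HC_CM is proved only modulo the 7 printed citations (2 remaining named inputs: hLiu418 = stmt-HodgeConjecture-24832, h413 = stmt-HodgeConjecture-24833) until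
rung 0 closes; count-neutral helper.

## Mathlib ∕ tree search
★ file 1 `integral_middleCellFun_mul_blockDiagonalGL ∕ _mul_unipotent ∕ _smoothIndRep_unipotentRadical ∕ integrable_middleCellFun` · ★ 1α′ `blockDiagonalGL_iota_mem_borel ∕ _mem_upperUnitriangular ∕
blockDiagonalGL_apply_block` · ★ 1α `inducingChar_eq_one_of_mem_upperUnitriangular` · ★ `det_fin_one_block` · ★ `coe_unramifiedTwist_one` · ★ `apply_eq_zero_of_mk_coinvariants_eq_zero`,
`isLimitOfCompactOpen_unipotentRadicalGL`, `ker_restrictUnipotentGL_eq` · ★ `inducingChar_apply` · Mathlib `Submodule.liftQ`, `LinearMap.quotKerEquivRange`, `LinearEquiv.ofEq`, `mem_indFun_iff`,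
`Representation.isSmoothVector_of_le`.  Dedup: `lean search 'middleCellMap|borelMultiplier'` — none.

## References
* [BernsteinZelevinsky1977] I. N. Bernstein, A. V. Zelevinsky, *Induced representations of reductive p-adic groups I*, Ann. Sci. ÉNS 10 (1977), 1.7–1.9, §2.3, Thm. 5.2.
* [Casselman1995] W. Casselman, *Introduction to the theory of admissible representations of p-adic reductive groups* (draft 1995), §6.3 (Prop. 6.3.1, Thm. 6.3.5).
-/

set_option autoImplicit false
set_option linter.dupNamespace false

noncomputable section

open Set Function MeasureTheory Measure Representation
open scoped MatrixGroups NNReal ENNReal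

namespace Summit.HodgeConjecture.HodgeConjecture.Cruxes.H413.K2E3GL3BorelInducedJacquetQMiddleCellMap

open Literature.NumberTheory.Automorphic ValuativeRel
open Literature.NumberTheory.GaloisRepresentations Literature.NumberTheory.GaloisRepresentations.IsNonarchimedeanLocalField
open Summit.HodgeConjecture.HodgeConjecture.Cruxes.H413.K2E3GL3BruhatCellSubgroups
open Summit.HodgeConjecture.HodgeConjecture.Cruxes.H413.K2E3GL3BruhatCellHaar
open Summit.HodgeConjecture.HodgeConjecture.Cruxes.H413.K2E3GL3BruhatCellFunctionals
open Summit.HodgeConjecture.HodgeConjecture.Cruxes.H413.K2E3BorelCellJacquetLine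
open Summit.HodgeConjecture.HodgeConjecture.Cruxes.H413.K2E3GL3BorelInducedJacquetQFiltration
open Summit.HodgeConjecture.HodgeConjecture.Cruxes.H413.K2E3GL3BorelInducedJacquetQClosedCellGL2
open Summit.HodgeConjecture.HodgeConjecture.Cruxes.H413.K2E3GL3BorelInducedJacquetQMiddleCellIntegrand
open Summit.HodgeConjecture.HodgeConjecture.Cruxes.H413.K2E3GL3PrincipalSeriesExponents (det_fin_one_block)
open Summit.HodgeConjecture.HodgeConjecture.Cruxes.H413.K2E3GL2UnlinkedIrreducible (coe_unramifiedTwist_one)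

variable {F : Type} [Field F] [ValuativeRel F] [TopologicalSpace F] [IsNonarchimedeanLocalField F] [MeasurableSpace F] [BorelSpace F]
  (μ : Measure F) [μ.IsAddHaarMeasure]
  (χ : (Π a : Fin 3, GL {i : Fin 3 // (id : Fin 3 → Fin 3) i = a} F) →* ℂˣ)
  (e : (F × F) × F ≃ₜ ↥(unipotentRadicalGL F (id : Fin 3 → Fin 3)))
  (he : ∀ p : (F × F) × F, (((e p : ↥(unipotentRadicalGL F (id : Fin 3 → Fin 3))) : GL (Fin 3) F) : Matrix (Fin 3) (Fin 3) F) = !![1, p.1.1, p.2; 0, 1, p.1.2; 0, 0, 1])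
include he

/-! ## §1 The Borel multiplier `C : B₃ →* ℂˣ` of the middle-cell integral -/

omit [ValuativeRel F] [TopologicalSpace F] [IsNonarchimedeanLocalField F] [MeasurableSpace F] [BorelSpace F] he in
/-- A diagonal entry of `diag(levi β)` is the determinant of the corresponding `1 × 1` block of `levi β`. [folklore] -/
theorem blockDiagonalGL_leviProjection_apply_diag (β : ↥(standardParabolicGL F (id : Fin 3 → Fin 3))) (i : Fin 3) :
    ((blockDiagonalGL F (id : Fin 3 → Fin 3) (leviProjection F (id : Fin 3 → Fin 3) β) : GL (Fin 3) F) : Matrix (Fin 3) (Fin 3) F) i i =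
      ((Matrix.GeneralLinearGroup.det (leviProjection F (id : Fin 3 → Fin 3) β i) : Fˣ) : F) := by
  rw [det_fin_one_block, ← blockDiagonalGL_apply_block (id : Fin 3 → Fin 3) (leviProjection F (id : Fin 3 → Fin 3) β) i ⟨i, rfl⟩ ⟨i, rfl⟩]

/-- **THE BOREL MULTIPLIER.**  There is a character `C : B₃ →* ℂˣ`, trivial on `U₃`, such that for every `f ∈ Ind_B σ′`, `β ∈ B₃` and `g`:
`∫ f(s₂ x₁₂(y) · β g) dμ(y) = C(β) · ∫ f(s₂ x₁₂(y) · g) dμ(y)` — namely `C(β) = σ′(s₂ t s₂⁻¹) · ‖t₁₁ ∕ t₂₂‖` for the diagonal part `t = diag(levi β)` of `β = t · u`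
(★ file 1: torus substitution, then the unipotent shift for `u`). [cite: BernsteinZelevinsky1977, 1.7, Thm. 5.2] [cite: Casselman1995, §6.3] -/
theorem exists_borelMultiplier :
    ∃ C : ↥(standardParabolicGL F (id : Fin 3 → Fin 3)) →* ℂˣ,
      (∀ (u : GL (Fin 3) F) (hu : u ∈ upperUnitriangular (Fin 3) F), C ⟨u, unipotentRadicalGL_le F (id : Fin 3 → Fin 3) hu⟩ = 1) ∧
      ∀ (f : SmoothInd (standardParabolicGL F (id : Fin 3 → Fin 3)) (Representation.twist (((Representation.trivial ℂ (Π a : Fin 3, GL {i : Fin 3 // (id : Fin 3 → Fin 3) i = a} F) ℂ).twist χ).comp (leviProjection F (id : Fin 3 → Fin 3))) (rootDeltaChar (standardParabolicGL F (id : Fin 3 → Fin 3))))) (β : ↥(standardParabolicGL F (id : Fin 3 → Fin 3))) (g : GL (Fin 3) F),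
        ∫ y, f.toFun ((permGL (Equiv.swap (1 : Fin 3) 2) : GL (Fin 3) F) * ((e ((0, y), 0) : ↥(unipotentRadicalGL F (id : Fin 3 → Fin 3))) : GL (Fin 3) F) * ((β : GL (Fin 3) F) * g)) ∂μ = ((C β : ℂˣ) : ℂ) * ∫ y, f.toFun ((permGL (Equiv.swap (1 : Fin 3) 2) : GL (Fin 3) F) * ((e ((0, y), 0) : ↥(unipotentRadicalGL F (id : Fin 3 → Fin 3))) : GL (Fin 3) F) * g) ∂μ := by
  haveI : IsTopologicalRing F := inferInstance
  -- the torus conjugation `t ↦ s₂ diag(t) s₂⁻¹ ∈ B₃`, the modulus `ν = ‖·‖`, and `C = (σ′ ∘ Ad(s₂) ∘ diag ∘ levi) · (ν∘det₁ ∕ ν∘det₂) ∘ levi`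
  let conjB : (Π a : Fin 3, GL {i : Fin 3 // (id : Fin 3 → Fin 3) i = a} F) →* ↥(standardParabolicGL F (id : Fin 3 → Fin 3)) :=
    ((MulAut.conj (permGL (Equiv.swap (1 : Fin 3) 2) : GL (Fin 3) F)).toMonoidHom.comp (blockDiagonalGL F (id : Fin 3 → Fin 3))).codRestrict (standardParabolicGL F (id : Fin 3 → Fin 3)) (fun m => permGL_swap_conj_blockDiagonalGL_mem m)
  let ν : Fˣ →* ℂˣ := (unramifiedTwist F 1 : QuasiChar F).toMonoidHom
  let C : ↥(standardParabolicGL F (id : Fin 3 → Fin 3)) →* ℂˣ :=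
    (((χ.comp (leviProjection F (id : Fin 3 → Fin 3))) * rootDeltaChar (standardParabolicGL F (id : Fin 3 → Fin 3))).comp (conjB.comp (leviProjection F (id : Fin 3 → Fin 3)))) *
      ((ν.comp (Matrix.GeneralLinearGroup.det.comp (Pi.evalMonoidHom (fun a : Fin 3 => GL {i : Fin 3 // (id : Fin 3 → Fin 3) i = a} F) 1))).comp (leviProjection F (id : Fin 3 → Fin 3)) *
        ((ν.comp (Matrix.GeneralLinearGroup.det.comp (Pi.evalMonoidHom (fun a : Fin 3 => GL {i : Fin 3 // (id : Fin 3 → Fin 3) i = a} F) 2))).comp (leviProjection F (id : Fin 3 → Fin 3)))⁻¹)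
  have hC : ∀ β : ↥(standardParabolicGL F (id : Fin 3 → Fin 3)), ((C β : ℂˣ) : ℂ) =
      ((((χ (leviProjection F (id : Fin 3 → Fin 3) (conjB (leviProjection F (id : Fin 3 → Fin 3) β)))) : ℂˣ) : ℂ) *
        ((rootDeltaChar (standardParabolicGL F (id : Fin 3 → Fin 3)) (conjB (leviProjection F (id : Fin 3 → Fin 3) β)) : ℂˣ) : ℂ)) *
      (((ν (Matrix.GeneralLinearGroup.det (leviProjection F (id : Fin 3 → Fin 3) β 1)) : ℂˣ) : ℂ) *
        (((ν (Matrix.GeneralLinearGroup.det (leviProjection F (id : Fin 3 → Fin 3) β 2)) : ℂˣ) : ℂ))⁻¹) := fun β => by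
    simp only [C, MonoidHom.mul_apply, MonoidHom.inv_apply, MonoidHom.coe_comp, Function.comp_apply, Pi.evalMonoidHom_apply, Units.val_mul, Units.val_inv_eq_inv_val]
  refine ⟨C, fun u hu => ?_, fun f β g => ?_⟩
  · -- `levi u = 1`
    have h1 : leviProjection F (id : Fin 3 → Fin 3) ⟨u, unipotentRadicalGL_le F (id : Fin 3 → Fin 3) hu⟩ = 1 := by
      obtain ⟨p, hp, rfl⟩ := hu
      exact (MonoidHom.mem_ker).1 hp
    simp only [C, MonoidHom.mul_apply, MonoidHom.inv_apply, MonoidHom.coe_comp, Function.comp_apply, h1, map_one, inv_one, mul_one]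
  · -- `β = t · n`, `t = diag(levi β)`, `n ∈ U₃`
    set m := leviProjection F (id : Fin 3 → Fin 3) β with hm_def
    have hn : (blockDiagonalGL F (id : Fin 3 → Fin 3) m)⁻¹ * (β : GL (Fin 3) F) ∈ upperUnitriangular (Fin 3) F := by
      refine ⟨(leviEmbeddingP F (id : Fin 3 → Fin 3) m)⁻¹ * β, (MonoidHom.mem_ker).2 ?_, ?_⟩
      · rw [map_mul, map_inv, hm_def, leviProjection_leviEmbeddingP_apply, inv_mul_cancel]
      · simp only [Subgroup.coe_subtype, Subgroup.coe_mul, Subgroup.coe_inv, coe_leviEmbeddingP]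
    have hprod : ∀ y, (permGL (Equiv.swap (1 : Fin 3) 2) : GL (Fin 3) F) * ((e ((0, y), 0) : ↥(unipotentRadicalGL F (id : Fin 3 → Fin 3))) : GL (Fin 3) F) * ((β : GL (Fin 3) F) * g) =
        (permGL (Equiv.swap (1 : Fin 3) 2) : GL (Fin 3) F) * ((e ((0, y), 0) : ↥(unipotentRadicalGL F (id : Fin 3 → Fin 3))) : GL (Fin 3) F) * blockDiagonalGL F (id : Fin 3 → Fin 3) m * (((blockDiagonalGL F (id : Fin 3 → Fin 3) m)⁻¹ * (β : GL (Fin 3) F)) * g) := fun y => by group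
    simp only [hprod]
    rw [integral_middleCellFun_mul_blockDiagonalGL μ χ e he f m]
    have hassoc : ∀ y, (permGL (Equiv.swap (1 : Fin 3) 2) : GL (Fin 3) F) * ((e ((0, y), 0) : ↥(unipotentRadicalGL F (id : Fin 3 → Fin 3))) : GL (Fin 3) F) * (((blockDiagonalGL F (id : Fin 3 → Fin 3) m)⁻¹ * (β : GL (Fin 3) F)) * g) =
        (permGL (Equiv.swap (1 : Fin 3) 2) : GL (Fin 3) F) * ((e ((0, y), 0) : ↥(unipotentRadicalGL F (id : Fin 3 → Fin 3))) : GL (Fin 3) F) * ((blockDiagonalGL F (id : Fin 3 → Fin 3) m)⁻¹ * (β : GL (Fin 3) F)) * g := fun y => (mul_assoc _ _ _).symm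
    simp only [hassoc]
    rw [integral_middleCellFun_mul_unipotent μ χ e he f hn g, hC]
    -- the scalar
    have hconj : (conjB m : ↥(standardParabolicGL F (id : Fin 3 → Fin 3))) = ⟨_, permGL_swap_conj_blockDiagonalGL_mem m⟩ := rfl
    have hd1 : ((blockDiagonalGL F (id : Fin 3 → Fin 3) m : GL (Fin 3) F) : Matrix (Fin 3) (Fin 3) F) 1 1 ≠ 0 := blockDiagonalGL_id_three_apply_ne_zero m 1
    have hd2 : ((blockDiagonalGL F (id : Fin 3 → Fin 3) m : GL (Fin 3) F) : Matrix (Fin 3) (Fin 3) F) 2 2 ≠ 0 := blockDiagonalGL_id_three_apply_ne_zero m 2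
    rw [hconj, coe_unramifiedTwist_one, coe_unramifiedTwist_one, ← blockDiagonalGL_leviProjection_apply_diag β 1, ← blockDiagonalGL_leviProjection_apply_diag β 2, ← hm_def,
      inv_div, map_div₀]
    have hn2 : ((normAbs F (((blockDiagonalGL F (id : Fin 3 → Fin 3) m : GL (Fin 3) F) : Matrix (Fin 3) (Fin 3) F) 2 2) : ℝ) : ℂ) ≠ 0 := by
      exact_mod_cast (map_ne_zero (normAbs F)).2 hd2
    push_cast
    field_simp

/-! ## §2 The block character `χ₂` of the diagonal torus of `GL₂` -/

section BlockChar

variable (ι : GL (Fin 2) F →* (Π a : Fin 2, GL {i : Fin 3 // (![0, 0, 1] : Fin 3 → Fin 2) i = a} F)) (hι : ∀ g : GL (Fin 2) F, (((blockDiagonalGL F (![0, 0, 1] : Fin 3 → Fin 2)) (ι g) : GL (Fin 3) F) : Matrix (Fin 3) (Fin 3) F) = !![(g : Matrix (Fin 2) (Fin 2) F) 0 0, (g : Matrix (Fin 2) (Fin 2) F) 0 1, 0; (g : Matrix (Fin 2) (Fin 2) F) 1 0, (g : Matrix (Fin 2) (Fin 2) F) 1 1, 0; 0, 0, 1])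
include hι

omit [MeasurableSpace F] [BorelSpace F] he hι in
/-- `τ_{χ₂}(b) z = δ_{B₂}^{1∕2}(b) · χ₂(levi₂ b) · z`. [cite: BernsteinZelevinsky1977, §2.3] -/
theorem inducingChar_two_apply (χ₂ : (Π a : Fin 2, GL {i : Fin 2 // (id : Fin 2 → Fin 2) i = a} F) →* ℂˣ) (b : ↥(standardParabolicGL F (id : Fin 2 → Fin 2))) (z : ℂ) :
    (Representation.twist (((Representation.trivial ℂ (Π a : Fin 2, GL {i : Fin 2 // (id : Fin 2 → Fin 2) i = a} F) ℂ).twist χ₂).comp (leviProjection F (id : Fin 2 → Fin 2))) (rootDeltaChar (standardParabolicGL F (id : Fin 2 → Fin 2)))) b z = ((rootDeltaChar (standardParabolicGL F (id : Fin 2 → Fin 2)) b : ℂˣ) : ℂ) * (((χ₂ (leviProjection F (id : Fin 2 → Fin 2) b) : ℂˣ) : ℂ) * z) := by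
  simp only [Representation.twist_apply, MonoidHom.coe_comp, Function.comp_apply, Representation.trivial_apply, smul_eq_mul]

/-- **THE BLOCK CHARACTER OF THE MIDDLE CELL.**  There is a character `χ₂` of the diagonal torus of `GL₂(F)` such that for `b ∈ B₂`, every `f ∈ Ind_B σ′` and every `g`:
`∫ f(s₂ x₁₂(y) · diag(ι b) g) dμ = τ_{χ₂}(b) (∫ f(s₂ x₁₂(y) · g) dμ)`, `τ_{χ₂} = (χ₂∘levi₂)·δ_{B₂}^{1∕2}` — `χ₂ = (C∘κ∘emb₂)·(δ_{B₂}^{1∕2}∘emb₂)⁻¹` with `κ b = diag(ι b)`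
(§1; the device of ★ 1α′ `exists_blockChar_inducingChar_eq`). [cite: BernsteinZelevinsky1977, 1.8, Thm. 5.2] -/
theorem exists_blockChar_middleCell :
    ∃ χ₂ : (Π a : Fin 2, GL {i : Fin 2 // (id : Fin 2 → Fin 2) i = a} F) →* ℂˣ, ∀ (b : GL (Fin 2) F) (hb : b ∈ (standardParabolicGL F (id : Fin 2 → Fin 2))) (f : SmoothInd (standardParabolicGL F (id : Fin 3 → Fin 3)) (Representation.twist (((Representation.trivial ℂ (Π a : Fin 3, GL {i : Fin 3 // (id : Fin 3 → Fin 3) i = a} F) ℂ).twist χ).comp (leviProjection F (id : Fin 3 → Fin 3))) (rootDeltaChar (standardParabolicGL F (id : Fin 3 → Fin 3))))) (g : GL (Fin 3) F),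
      ∫ y, f.toFun ((permGL (Equiv.swap (1 : Fin 3) 2) : GL (Fin 3) F) * ((e ((0, y), 0) : ↥(unipotentRadicalGL F (id : Fin 3 → Fin 3))) : GL (Fin 3) F) * (((blockDiagonalGL F (![0, 0, 1] : Fin 3 → Fin 2)) (ι b) : GL (Fin 3) F) * g)) ∂μ =
        (Representation.twist (((Representation.trivial ℂ (Π a : Fin 2, GL {i : Fin 2 // (id : Fin 2 → Fin 2) i = a} F) ℂ).twist χ₂).comp (leviProjection F (id : Fin 2 → Fin 2))) (rootDeltaChar (standardParabolicGL F (id : Fin 2 → Fin 2)))) ⟨b, hb⟩ (∫ y, f.toFun ((permGL (Equiv.swap (1 : Fin 3) 2) : GL (Fin 3) F) * ((e ((0, y), 0) : ↥(unipotentRadicalGL F (id : Fin 3 → Fin 3))) : GL (Fin 3) F) * g) ∂μ) := by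
  haveI : IsTopologicalRing F := inferInstance
  obtain ⟨C, hCU, hC⟩ := exists_borelMultiplier μ χ e he
  -- `κ : B₂ →* B₃`, `b ↦ diag(ι b)`
  let κ : ↥(standardParabolicGL F (id : Fin 2 → Fin 2)) →* ↥(standardParabolicGL F (id : Fin 3 → Fin 3)) := (((blockDiagonalGL F (![0, 0, 1] : Fin 3 → Fin 2)).comp ι).comp (standardParabolicGL F (id : Fin 2 → Fin 2)).subtype).codRestrict (standardParabolicGL F (id : Fin 3 → Fin 3)) (fun b => blockDiagonalGL_iota_mem_borel ι hι b.2)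
  have hκ : ∀ b : ↥(standardParabolicGL F (id : Fin 2 → Fin 2)), ((κ b : ↥(standardParabolicGL F (id : Fin 3 → Fin 3))) : GL (Fin 3) F) = ((blockDiagonalGL F (![0, 0, 1] : Fin 3 → Fin 2)) (ι b) : GL (Fin 3) F) := fun b => rfl
  let χ₂ : (Π a : Fin 2, GL {i : Fin 2 // (id : Fin 2 → Fin 2) i = a} F) →* ℂˣ := (C.comp (κ.comp (leviEmbeddingP F (id : Fin 2 → Fin 2)))) * ((rootDeltaChar (standardParabolicGL F (id : Fin 2 → Fin 2))).comp (leviEmbeddingP F (id : Fin 2 → Fin 2)))⁻¹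
  have hχ₂ : ∀ t, χ₂ t = C (κ (leviEmbeddingP F (id : Fin 2 → Fin 2) t)) * (rootDeltaChar (standardParabolicGL F (id : Fin 2 → Fin 2)) (leviEmbeddingP F (id : Fin 2 → Fin 2) t))⁻¹ := fun t => rfl
  refine ⟨χ₂, fun b hb f g => ?_⟩
  -- `⟨b, hb⟩ = emb₂(t) · u` with `u ∈ U₂`
  obtain ⟨t, u, hu, hbu⟩ : ∃ (t : (Π a : Fin 2, GL {i : Fin 2 // (id : Fin 2 → Fin 2) i = a} F)) (u : ↥(standardParabolicGL F (id : Fin 2 → Fin 2))), u ∈ unipotentRadicalP F (id : Fin 2 → Fin 2) ∧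
      (⟨b, hb⟩ : ↥(standardParabolicGL F (id : Fin 2 → Fin 2))) = leviEmbeddingP F (id : Fin 2 → Fin 2) t * u :=
    ⟨leviProjection F (id : Fin 2 → Fin 2) ⟨b, hb⟩, (leviEmbeddingP F (id : Fin 2 → Fin 2) (leviProjection F (id : Fin 2 → Fin 2) ⟨b, hb⟩))⁻¹ * ⟨b, hb⟩,
      by rw [MonoidHom.mem_ker, map_mul, map_inv, leviProjection_leviEmbeddingP_apply, inv_mul_cancel], by rw [mul_inv_cancel_left]⟩
  have hu2 : ((u : ↥(standardParabolicGL F (id : Fin 2 → Fin 2))) : GL (Fin 2) F) ∈ upperUnitriangular (Fin 2) F := ⟨u, hu, rfl⟩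
  -- the left side: `C (κ ⟨b, hb⟩) = C (κ (emb t))` (`C` kills `κ u ∈ U₃`)
  have hleft := hC f (κ ⟨b, hb⟩) g
  rw [hκ] at hleft
  have hCu : C (κ u) = 1 := hCU _ (blockDiagonalGL_iota_mem_upperUnitriangular ι hι hu2)
  have hCb : C (κ ⟨b, hb⟩) = C (κ (leviEmbeddingP F (id : Fin 2 → Fin 2) t)) := by rw [hbu, map_mul, map_mul, hCu, mul_one]
  rw [hleft, hCb]
  -- the right side: `τ(emb t · u) = τ(emb t)`, `τ(emb t) z = δ(emb t) χ₂(t) z = C(κ (emb t)) z`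
  have hτu : (Representation.twist (((Representation.trivial ℂ (Π a : Fin 2, GL {i : Fin 2 // (id : Fin 2 → Fin 2) i = a} F) ℂ).twist χ₂).comp (leviProjection F (id : Fin 2 → Fin 2))) (rootDeltaChar (standardParabolicGL F (id : Fin 2 → Fin 2)))) u = 1 := inducingChar_eq_one_of_mem_upperUnitriangular χ₂ (u : GL (Fin 2) F) hu2
  rw [hbu, map_mul, Module.End.mul_apply, hτu, Module.End.one_apply, inducingChar_two_apply, leviProjection_leviEmbeddingP_apply, hχ₂, Units.val_mul,
    Units.val_inv_eq_inv_val]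
  have hδ : ((rootDeltaChar (standardParabolicGL F (id : Fin 2 → Fin 2)) (leviEmbeddingP F (id : Fin 2 → Fin 2) t) : ℂˣ) : ℂ) ≠ 0 := Units.ne_zero _
  field_simp

end BlockChar

/-! ## §3 The middle-cell map `Ψ₁ : J₁ → I₂(χ₂)` and its value formula -/

section Map

variable (ι : GL (Fin 2) F →* (Π a : Fin 2, GL {i : Fin 3 // (![0, 0, 1] : Fin 3 → Fin 2) i = a} F))
  (hι : ∀ g : GL (Fin 2) F, (((blockDiagonalGL F (![0, 0, 1] : Fin 3 → Fin 2)) (ι g) : GL (Fin 3) F) : Matrix (Fin 3) (Fin 3) F) = !![(g : Matrix (Fin 2) (Fin 2) F) 0 0, (g : Matrix (Fin 2) (Fin 2) F) 0 1, 0; (g : Matrix (Fin 2) (Fin 2) F) 1 0, (g : Matrix (Fin 2) (Fin 2) F) 1 1, 0; 0, 0, 1])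
  (hιc : Continuous ι)
include hι hιc

set_option maxHeartbeats 1600000 in  -- the long induced-space types (elaboration ∕ `whnf`, no search)
/-- **THE MIDDLE-CELL MAP WITH ITS VALUE FORMULA (letter L1 of E4b-3 minus its kernel clause).**  For the principal series `I χ = Ind_{B₃}(χ δ^{1∕2})` of `GL₃(F)`,
a continuous block embedding `ι` (`diag(ι g) = diag(g,1)`), and the subrepresentation `J₁ ≤ r_{(2,1)}(I χ)` of classes of functions vanishing on `P_{(2,1)}` (∃-membership
form of ★ 1α): there are a character `χ₂` of the diagonal torus of `GL₂(F)` and a linear map `Ψ : J₁ → I₂(χ₂)` with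
`(Ψ [f])(g) = ∫_F f(s₂ · x₁₂(y) · diag(ι g)) dμ(y)` for `f` vanishing on `P_{(2,1)}` and `Ψ ((ι g) · a) = g · Ψ a`.  (The integral is `U_P`-invariant, ★ file 1, so it
descends through ★ `apply_eq_zero_of_mk_coinvariants_eq_zero`; it is `B₂`-equivariant by §2 and smooth along `(diag ∘ ι)⁻¹` of the stabiliser of `f`.)
[cite: BernsteinZelevinsky1977, Thm. 5.2] [cite: Casselman1995, §6.3, Thm. 6.3.5] -/
theorem exists_middleCellMap_formula
    (J₁ : Subrepresentation (jacquetGL F (![0, 0, 1] : Fin 3 → Fin 2) (smoothIndRep (standardParabolicGL F (id : Fin 3 → Fin 3)) (Representation.twist (((Representation.trivial ℂ (Π a : Fin 3, GL {i : Fin 3 // (id : Fin 3 → Fin 3) i = a} F) ℂ).twist χ).comp (leviProjection F (id : Fin 3 → Fin 3))) (rootDeltaChar (standardParabolicGL F (id : Fin 3 → Fin 3)))))))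
    (hJ₁ : ∀ x, x ∈ J₁ ↔ ∃ f ∈ (vanishingOn (standardParabolicGL F (id : Fin 3 → Fin 3)) (Representation.twist (((Representation.trivial ℂ (Π a : Fin 3, GL {i : Fin 3 // (id : Fin 3 → Fin 3) i = a} F) ℂ).twist χ).comp (leviProjection F (id : Fin 3 → Fin 3))) (rootDeltaChar (standardParabolicGL F (id : Fin 3 → Fin 3)))) (standardParabolicGL F (![0, 0, 1] : Fin 3 → Fin 2) : Set (GL (Fin 3) F))), Representation.Coinvariants.mk (restrictUnipotentGL F (![0, 0, 1] : Fin 3 → Fin 2) (smoothIndRep (standardParabolicGL F (id : Fin 3 → Fin 3)) (Representation.twist (((Representation.trivial ℂ (Π a : Fin 3, GL {i : Fin 3 // (id : Fin 3 → Fin 3) i = a} F) ℂ).twist χ).comp (leviProjection F (id : Fin 3 → Fin 3))) (rootDeltaChar (standardParabolicGL F (id : Fin 3 → Fin 3)))))) f = x) :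
    ∃ (χ₂ : (Π a : Fin 2, GL {i : Fin 2 // (id : Fin 2 → Fin 2) i = a} F) →* ℂˣ) (Ψ : J₁.toSubmodule →ₗ[ℂ] SmoothInd (standardParabolicGL F (id : Fin 2 → Fin 2)) (Representation.twist (((Representation.trivial ℂ (Π a : Fin 2, GL {i : Fin 2 // (id : Fin 2 → Fin 2) i = a} F) ℂ).twist χ₂).comp (leviProjection F (id : Fin 2 → Fin 2))) (rootDeltaChar (standardParabolicGL F (id : Fin 2 → Fin 2))))),
      (∀ (f : SmoothInd (standardParabolicGL F (id : Fin 3 → Fin 3)) (Representation.twist (((Representation.trivial ℂ (Π a : Fin 3, GL {i : Fin 3 // (id : Fin 3 → Fin 3) i = a} F) ℂ).twist χ).comp (leviProjection F (id : Fin 3 → Fin 3))) (rootDeltaChar (standardParabolicGL F (id : Fin 3 → Fin 3))))) (hf : f ∈ (vanishingOn (standardParabolicGL F (id : Fin 3 → Fin 3)) (Representation.twist (((Representation.trivial ℂ (Π a : Fin 3, GL {i : Fin 3 // (id : Fin 3 → Fin 3) i = a} F) ℂ).twist χ).comp (leviProjection F (id : Fin 3 → Fin 3))) (rootDeltaChar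 (standardParabolicGL F (id : Fin 3 → Fin 3)))) (standardParabolicGL F (![0, 0, 1] : Fin 3 → Fin 2) : Set (GL (Fin 3) F)))) (g : GL (Fin 2) F),
        (Ψ ⟨Representation.Coinvariants.mk (restrictUnipotentGL F (![0, 0, 1] : Fin 3 → Fin 2) (smoothIndRep (standardParabolicGL F (id : Fin 3 → Fin 3)) (Representation.twist (((Representation.trivial ℂ (Π a : Fin 3, GL {i : Fin 3 // (id : Fin 3 → Fin 3) i = a} F) ℂ).twist χ).comp (leviProjection F (id : Fin 3 → Fin 3))) (rootDeltaChar (standardParabolicGL F (id : Fin 3 → Fin 3)))))) f, (hJ₁ _).2 ⟨f, hf, rfl⟩⟩).toFun g = ∫ y, f.toFun ((permGL (Equiv.swap (1 : Fin 3) 2) : GL (Fin 3) F) * ((e ((0, y), 0) : ↥(unipotentRadicalGL F (id : Fin 3 → Fin 3))) : GL (Fin 3) F) * ((blockDiagonalGL F (![0, 0, 1] : Fin 3 → Fin 2)) (ι g) : GL (Fin 3) F)) ∂μ) ∧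
      (∀ (g : GL (Fin 2) F) (a : J₁.toSubmodule), Ψ (J₁.toRepresentation (ι g) a) = (parabolicIndGL F (id : Fin 2 → Fin 2) ((Representation.trivial ℂ (Π a : Fin 2, GL {i : Fin 2 // (id : Fin 2 → Fin 2) i = a} F) ℂ).twist χ₂)) g (Ψ a)) := by
  haveI : IsTopologicalRing F := inferInstance
  obtain ⟨χ₂, hχ₂⟩ := exists_blockChar_middleCell μ χ e he ι hι
  have hint : ∀ (f : SmoothInd (standardParabolicGL F (id : Fin 3 → Fin 3)) (Representation.twist (((Representation.trivial ℂ (Π a : Fin 3, GL {i : Fin 3 // (id : Fin 3 → Fin 3) i = a} F) ℂ).twist χ).comp (leviProjection F (id : Fin 3 → Fin 3))) (rootDeltaChar (standardParabolicGL F (id : Fin 3 → Fin 3))))) (hf : f ∈ (vanishingOn (standardParabolicGL F (id : Fin 3 → Fin 3)) (Representation.twist (((Representation.trivial ℂ (Π a : Fin 3, GL {i : Fin 3 // (id : Fin 3 → Fin 3) i = a} F) ℂ).twist χ).comp (leviProjection F (id : Fin 3 → Fin 3))) (rootDeltaChar (standardParabolicGL F (id : Fin 3 → Fin 3)))) (standardParabolicGL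 F (![0, 0, 1] : Fin 3 → Fin 2) : Set (GL (Fin 3) F)))) (g : GL (Fin 2) F),
      Integrable (fun y : F => f.toFun ((permGL (Equiv.swap (1 : Fin 3) 2) : GL (Fin 3) F) * ((e ((0, y), 0) : ↥(unipotentRadicalGL F (id : Fin 3 → Fin 3))) : GL (Fin 3) F) * ((blockDiagonalGL F (![0, 0, 1] : Fin 3 → Fin 2)) (ι g) : GL (Fin 3) F))) μ := fun f hf g =>
    integrable_middleCellFun e he μ _ f hf (blockDiagonalGL_mem (![0, 0, 1] : Fin 3 → Fin 2) (ι g))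
  -- the cell integral of `f ∈ X¹` as an element of `I₂(χ₂)`
  let Φ : (vanishingOn (standardParabolicGL F (id : Fin 3 → Fin 3)) (Representation.twist (((Representation.trivial ℂ (Π a : Fin 3, GL {i : Fin 3 // (id : Fin 3 → Fin 3) i = a} F) ℂ).twist χ).comp (leviProjection F (id : Fin 3 → Fin 3))) (rootDeltaChar (standardParabolicGL F (id : Fin 3 → Fin 3)))) (standardParabolicGL F (![0, 0, 1] : Fin 3 → Fin 2) : Set (GL (Fin 3) F))) →ₗ[ℂ] SmoothInd (standardParabolicGL F (id : Fin 2 → Fin 2)) (Representation.twist (((Representation.trivial ℂ (Π a : Fin 2, GL {i : Fin 2 // (id : Fin 2 → Fin 2) i = a} F) ℂ).twist χ₂).comp (leviProjection F (id : Fin 2 → Fin 2))) (rootDeltaChar (standardParabolicGL F (id : Fin 2 → Fin 2)))) :=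
    { toFun := fun f => by
        refine (⟨⟨fun g => ∫ y, (f : SmoothInd (standardParabolicGL F (id : Fin 3 → Fin 3)) (Representation.twist (((Representation.trivial ℂ (Π a : Fin 3, GL {i : Fin 3 // (id : Fin 3 → Fin 3) i = a} F) ℂ).twist χ).comp (leviProjection F (id : Fin 3 → Fin 3))) (rootDeltaChar (standardParabolicGL F (id : Fin 3 → Fin 3))))).toFun ((permGL (Equiv.swap (1 : Fin 3) 2) : GL (Fin 3) F) * ((e ((0, y), 0) : ↥(unipotentRadicalGL F (id : Fin 3 → Fin 3))) : GL (Fin 3) F) * ((blockDiagonalGL F (![0, 0, 1] : Fin 3 → Fin 2)) (ι g) : GL (Fin 3) F)) ∂μ, ?_⟩, ?_⟩ :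
          ↥(smoothInd (standardParabolicGL F (id : Fin 2 → Fin 2)) (Representation.twist (((Representation.trivial ℂ (Π a : Fin 2, GL {i : Fin 2 // (id : Fin 2 → Fin 2) i = a} F) ℂ).twist χ₂).comp (leviProjection F (id : Fin 2 → Fin 2))) (rootDeltaChar (standardParabolicGL F (id : Fin 2 → Fin 2))))).toSubmodule)
        · rw [mem_indFun_iff]
          intro b g
          rw [map_mul, map_mul]
          exact hχ₂ (b : GL (Fin 2) F) b.2 _ _
        · refine (indFun (standardParabolicGL F (id : Fin 2 → Fin 2)) (Representation.twist (((Representation.trivial ℂ (Π a : Fin 2, GL {i : Fin 2 // (id : Fin 2 → Fin 2) i = a} F) ℂ).twist χ₂).comp (leviProjection F (id : Fin 2 → Fin 2))) (rootDeltaChar (standardParabolicGL F (id : Fin 2 → Fin 2))))).isSmoothVector_of_le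
            (K := ((smoothIndRep (standardParabolicGL F (id : Fin 3 → Fin 3)) (Representation.twist (((Representation.trivial ℂ (Π a : Fin 3, GL {i : Fin 3 // (id : Fin 3 → Fin 3) i = a} F) ℂ).twist χ).comp (leviProjection F (id : Fin 3 → Fin 3))) (rootDeltaChar (standardParabolicGL F (id : Fin 3 → Fin 3))))).stabilizerSubgroup (f : SmoothInd (standardParabolicGL F (id : Fin 3 → Fin 3)) (Representation.twist (((Representation.trivial ℂ (Π a : Fin 3, GL {i : Fin 3 // (id : Fin 3 → Fin 3) i = a} F) ℂ).twist χ).comp (leviProjection F (id : Fin 3 → Fin 3))) (rootDeltaChar (standardParabolicGL F (id : Fin 3 → Fin 3)))))).comap ((blockDiagonalGL F (![0, 0, 1] : Fin 3 → Fin 2)).comp ι))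
            ((isSmooth_smoothInd (standardParabolicGL F (id : Fin 3 → Fin 3)) (Representation.twist (((Representation.trivial ℂ (Π a : Fin 3, GL {i : Fin 3 // (id : Fin 3 → Fin 3) i = a} F) ℂ).twist χ).comp (leviProjection F (id : Fin 3 → Fin 3))) (rootDeltaChar (standardParabolicGL F (id : Fin 3 → Fin 3)))) (f : SmoothInd (standardParabolicGL F (id : Fin 3 → Fin 3)) (Representation.twist (((Representation.trivial ℂ (Π a : Fin 3, GL {i : Fin 3 // (id : Fin 3 → Fin 3) i = a} F) ℂ).twist χ).comp (leviProjection F (id : Fin 3 → Fin 3))) (rootDeltaChar (standardParabolicGL F (id : Fin 3 → Fin 3)))))).preimage ((continuous_blockDiagonalGL F (![0, 0, 1] : Fin 3 → Fin 2)).comp hιc)) fun u hu => ?_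
          rw [mem_stabilizerSubgroup]
          refine Subtype.ext (funext fun g => ?_)
          rw [indFun_apply_apply]
          change ∫ y, (f : SmoothInd (standardParabolicGL F (id : Fin 3 → Fin 3)) (Representation.twist (((Representation.trivial ℂ (Π a : Fin 3, GL {i : Fin 3 // (id : Fin 3 → Fin 3) i = a} F) ℂ).twist χ).comp (leviProjection F (id : Fin 3 → Fin 3))) (rootDeltaChar (standardParabolicGL F (id : Fin 3 → Fin 3))))).toFun ((permGL (Equiv.swap (1 : Fin 3) 2) : GL (Fin 3) F) * ((e ((0, y), 0) : ↥(unipotentRadicalGL F (id : Fin 3 → Fin 3))) : GL (Fin 3) F) * ((blockDiagonalGL F (![0, 0, 1] : Fin 3 → Fin 2)) (ι (g * u)) : GL (Fin 3) F)) ∂μ =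
            ∫ y, (f : SmoothInd (standardParabolicGL F (id : Fin 3 → Fin 3)) (Representation.twist (((Representation.trivial ℂ (Π a : Fin 3, GL {i : Fin 3 // (id : Fin 3 → Fin 3) i = a} F) ℂ).twist χ).comp (leviProjection F (id : Fin 3 → Fin 3))) (rootDeltaChar (standardParabolicGL F (id : Fin 3 → Fin 3))))).toFun ((permGL (Equiv.swap (1 : Fin 3) 2) : GL (Fin 3) F) * ((e ((0, y), 0) : ↥(unipotentRadicalGL F (id : Fin 3 → Fin 3))) : GL (Fin 3) F) * ((blockDiagonalGL F (![0, 0, 1] : Fin 3 → Fin 2)) (ι g) : GL (Fin 3) F)) ∂μ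
          have hu' : (smoothIndRep (standardParabolicGL F (id : Fin 3 → Fin 3)) (Representation.twist (((Representation.trivial ℂ (Π a : Fin 3, GL {i : Fin 3 // (id : Fin 3 → Fin 3) i = a} F) ℂ).twist χ).comp (leviProjection F (id : Fin 3 → Fin 3))) (rootDeltaChar (standardParabolicGL F (id : Fin 3 → Fin 3))))) (((blockDiagonalGL F (![0, 0, 1] : Fin 3 → Fin 2)) (ι u) : GL (Fin 3) F)) (f : SmoothInd (standardParabolicGL F (id : Fin 3 → Fin 3)) (Representation.twist (((Representation.trivial ℂ (Π a : Fin 3, GL {i : Fin 3 // (id : Fin 3 → Fin 3) i = a} F) ℂ).twist χ).comp (leviProjection F (id : Fin 3 → Fin 3))) (rootDeltaChar (standardParabolicGL F (id : Fin 3 → Fin 3))))) = f := Subgroup.mem_comap.1 hu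
          have hpt : ∀ y, (f : SmoothInd (standardParabolicGL F (id : Fin 3 → Fin 3)) (Representation.twist (((Representation.trivial ℂ (Π a : Fin 3, GL {i : Fin 3 // (id : Fin 3 → Fin 3) i = a} F) ℂ).twist χ).comp (leviProjection F (id : Fin 3 → Fin 3))) (rootDeltaChar (standardParabolicGL F (id : Fin 3 → Fin 3))))).toFun ((permGL (Equiv.swap (1 : Fin 3) 2) : GL (Fin 3) F) * ((e ((0, y), 0) : ↥(unipotentRadicalGL F (id : Fin 3 → Fin 3))) : GL (Fin 3) F) * ((blockDiagonalGL F (![0, 0, 1] : Fin 3 → Fin 2)) (ι (g * u)) : GL (Fin 3) F)) =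
              (f : SmoothInd (standardParabolicGL F (id : Fin 3 → Fin 3)) (Representation.twist (((Representation.trivial ℂ (Π a : Fin 3, GL {i : Fin 3 // (id : Fin 3 → Fin 3) i = a} F) ℂ).twist χ).comp (leviProjection F (id : Fin 3 → Fin 3))) (rootDeltaChar (standardParabolicGL F (id : Fin 3 → Fin 3))))).toFun ((permGL (Equiv.swap (1 : Fin 3) 2) : GL (Fin 3) F) * ((e ((0, y), 0) : ↥(unipotentRadicalGL F (id : Fin 3 → Fin 3))) : GL (Fin 3) F) * ((blockDiagonalGL F (![0, 0, 1] : Fin 3 → Fin 2)) (ι g) : GL (Fin 3) F)) := fun y => by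
            conv_rhs => rw [← hu', toFun_smoothIndRep_apply]
            rw [map_mul, map_mul, ← mul_assoc]
          simp only [hpt]
      map_add' := fun f f' => SmoothInd.ext (funext fun g => by
        change ∫ y, ((f + f' : (vanishingOn (standardParabolicGL F (id : Fin 3 → Fin 3)) (Representation.twist (((Representation.trivial ℂ (Π a : Fin 3, GL {i : Fin 3 // (id : Fin 3 → Fin 3) i = a} F) ℂ).twist χ).comp (leviProjection F (id : Fin 3 → Fin 3))) (rootDeltaChar (standardParabolicGL F (id : Fin 3 → Fin 3)))) (standardParabolicGL F (![0, 0, 1] : Fin 3 → Fin 2) : Set (GL (Fin 3) F)))) : SmoothInd (standardParabolicGL F (id : Fin 3 → Fin 3)) (Representation.twist (((Representation.trivial ℂ (Π a : Fin 3, GL {i : Fin 3 // (id : Fin 3 → Fin 3) i = a} F) ℂ).twist χ).comp (leviProjection F (id : Fin 3 → Fin 3))) (rootDeltaChar (standardParabolicGL F (id : Fin 3 → Fin 3))))).toFun ((permGL (Equiv.swap (1 : Fin 3) 2) : GL (Fin 3) F) * ((e ((0, y), 0) : ↥(unipotentRadicalGL F (id : Fin 3 → Fin 3))) : GL (Fin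 3) F) * ((blockDiagonalGL F (![0, 0, 1] : Fin 3 → Fin 2)) (ι g) : GL (Fin 3) F)) ∂μ =
          ∫ y, (f : SmoothInd (standardParabolicGL F (id : Fin 3 → Fin 3)) (Representation.twist (((Representation.trivial ℂ (Π a : Fin 3, GL {i : Fin 3 // (id : Fin 3 → Fin 3) i = a} F) ℂ).twist χ).comp (leviProjection F (id : Fin 3 → Fin 3))) (rootDeltaChar (standardParabolicGL F (id : Fin 3 → Fin 3))))).toFun ((permGL (Equiv.swap (1 : Fin 3) 2) : GL (Fin 3) F) * ((e ((0, y), 0) : ↥(unipotentRadicalGL F (id : Fin 3 → Fin 3))) : GL (Fin 3) F) * ((blockDiagonalGL F (![0, 0, 1] : Fin 3 → Fin 2)) (ι g) : GL (Fin 3) F)) ∂μ + ∫ y, (f' : SmoothInd (standardParabolicGL F (id : Fin 3 → Fin 3)) (Representation.twist (((Representation.trivial ℂ (Π a : Fin 3, GL {i : Fin 3 // (id : Fin 3 → Fin 3) i = a} F) ℂ).twist χ).comp (leviProjection F (id : Fin 3 → Fin 3))) (rootDeltaChar (standardParabolicGL F (id : Fin 3 → Fin 3))))).toFun ((permGL (Equiv.swap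 (1 : Fin 3) 2) : GL (Fin 3) F) * ((e ((0, y), 0) : ↥(unipotentRadicalGL F (id : Fin 3 → Fin 3))) : GL (Fin 3) F) * ((blockDiagonalGL F (![0, 0, 1] : Fin 3 → Fin 2)) (ι g) : GL (Fin 3) F)) ∂μ
        simp only [Submodule.coe_add, SmoothInd.toFun_add, Pi.add_apply]
        exact integral_add (hint f.1 f.2 g) (hint f'.1 f'.2 g))
      map_smul' := fun a f => SmoothInd.ext (funext fun g => by
        change ∫ y, ((a • f : (vanishingOn (standardParabolicGL F (id : Fin 3 → Fin 3)) (Representation.twist (((Representation.trivial ℂ (Π a : Fin 3, GL {i : Fin 3 // (id : Fin 3 → Fin 3) i = a} F) ℂ).twist χ).comp (leviProjection F (id : Fin 3 → Fin 3))) (rootDeltaChar (standardParabolicGL F (id : Fin 3 → Fin 3)))) (standardParabolicGL F (![0, 0, 1] : Fin 3 → Fin 2) : Set (GL (Fin 3) F)))) : SmoothInd (standardParabolicGL F (id : Fin 3 → Fin 3)) (Representation.twist (((Representation.trivial ℂ (Π a : Fin 3, GL {i : Fin 3 // (id : Fin 3 → Fin 3) i = a} F) ℂ).twist χ).comp (leviProjection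 F (id : Fin 3 → Fin 3))) (rootDeltaChar (standardParabolicGL F (id : Fin 3 → Fin 3))))).toFun ((permGL (Equiv.swap (1 : Fin 3) 2) : GL (Fin 3) F) * ((e ((0, y), 0) : ↥(unipotentRadicalGL F (id : Fin 3 → Fin 3))) : GL (Fin 3) F) * ((blockDiagonalGL F (![0, 0, 1] : Fin 3 → Fin 2)) (ι g) : GL (Fin 3) F)) ∂μ =
          a • ∫ y, (f : SmoothInd (standardParabolicGL F (id : Fin 3 → Fin 3)) (Representation.twist (((Representation.trivial ℂ (Π a : Fin 3, GL {i : Fin 3 // (id : Fin 3 → Fin 3) i = a} F) ℂ).twist χ).comp (leviProjection F (id : Fin 3 → Fin 3))) (rootDeltaChar (standardParabolicGL F (id : Fin 3 → Fin 3))))).toFun ((permGL (Equiv.swap (1 : Fin 3) 2) : GL (Fin 3) F) * ((e ((0, y), 0) : ↥(unipotentRadicalGL F (id : Fin 3 → Fin 3))) : GL (Fin 3) F) * ((blockDiagonalGL F (![0, 0, 1] : Fin 3 → Fin 2)) (ι g) : GL (Fin 3) F)) ∂μ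
        simp only [Submodule.coe_smul, SmoothInd.toFun_smul, Pi.smul_apply, smul_eq_mul]
        exact integral_const_mul a _) }
  have hΦ : ∀ (f : (vanishingOn (standardParabolicGL F (id : Fin 3 → Fin 3)) (Representation.twist (((Representation.trivial ℂ (Π a : Fin 3, GL {i : Fin 3 // (id : Fin 3 → Fin 3) i = a} F) ℂ).twist χ).comp (leviProjection F (id : Fin 3 → Fin 3))) (rootDeltaChar (standardParabolicGL F (id : Fin 3 → Fin 3)))) (standardParabolicGL F (![0, 0, 1] : Fin 3 → Fin 2) : Set (GL (Fin 3) F)))) (g : GL (Fin 2) F), (Φ f).toFun g = ∫ y, (f : SmoothInd (standardParabolicGL F (id : Fin 3 → Fin 3)) (Representation.twist (((Representation.trivial ℂ (Π a : Fin 3, GL {i : Fin 3 // (id : Fin 3 → Fin 3) i = a} F) ℂ).twist χ).comp (leviProjection F (id : Fin 3 → Fin 3))) (rootDeltaChar (standardParabolicGL F (id : Fin 3 → Fin 3))))).toFun ((permGL (Equiv.swap (1 : Fin 3) 2) : GL (Fin 3) F) * ((e ((0, y), 0) : ↥(unipotentRadicalGL F (id : Fin 3 → Fin 3))) : GL (Fin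 3) F) * ((blockDiagonalGL F (![0, 0, 1] : Fin 3 → Fin 2)) (ι g) : GL (Fin 3) F)) ∂μ := fun f g => rfl
  -- `U_P`-invariance (★ file 1) and descent through the classes (★ `apply_eq_zero_of_mk_coinvariants_eq_zero`)
  let ρU : Representation ℂ ↥(unipotentRadicalGL F (![0, 0, 1] : Fin 3 → Fin 2)) (SmoothInd (standardParabolicGL F (id : Fin 3 → Fin 3)) (Representation.twist (((Representation.trivial ℂ (Π a : Fin 3, GL {i : Fin 3 // (id : Fin 3 → Fin 3) i = a} F) ℂ).twist χ).comp (leviProjection F (id : Fin 3 → Fin 3))) (rootDeltaChar (standardParabolicGL F (id : Fin 3 → Fin 3))))) := (smoothIndRep (standardParabolicGL F (id : Fin 3 → Fin 3)) (Representation.twist (((Representation.trivial ℂ (Π a : Fin 3, GL {i : Fin 3 // (id : Fin 3 → Fin 3) i = a} F) ℂ).twist χ).comp (leviProjection F (id : Fin 3 → Fin 3))) (rootDeltaChar (standardParabolicGL F (id : Fin 3 → Fin 3))))).comp (unipotentRadicalGL F (![0, 0, 1] : Fin 3 → Fin 2)).subtype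
  have hρU : ρU.IsSmooth := (isSmooth_smoothInd (standardParabolicGL F (id : Fin 3 → Fin 3)) (Representation.twist (((Representation.trivial ℂ (Π a : Fin 3, GL {i : Fin 3 // (id : Fin 3 → Fin 3) i = a} F) ℂ).twist χ).comp (leviProjection F (id : Fin 3 → Fin 3))) (rootDeltaChar (standardParabolicGL F (id : Fin 3 → Fin 3))))).comp _ continuous_subtype_val
  have hstabU : ∀ (u : ↥(unipotentRadicalGL F (![0, 0, 1] : Fin 3 → Fin 2))) ⦃f : SmoothInd (standardParabolicGL F (id : Fin 3 → Fin 3)) (Representation.twist (((Representation.trivial ℂ (Π a : Fin 3, GL {i : Fin 3 // (id : Fin 3 → Fin 3) i = a} F) ℂ).twist χ).comp (leviProjection F (id : Fin 3 → Fin 3))) (rootDeltaChar (standardParabolicGL F (id : Fin 3 → Fin 3))))⦄, f ∈ (vanishingOn (standardParabolicGL F (id : Fin 3 → Fin 3)) (Representation.twist (((Representation.trivial ℂ (Π a : Fin 3, GL {i : Fin 3 // (id : Fin 3 → Fin 3) i = a} F) ℂ).twist χ).comp (leviProjection F (id : Fin 3 → Fin 3))) (rootDeltaChar (standardParabolicGL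 F (id : Fin 3 → Fin 3)))) (standardParabolicGL F (![0, 0, 1] : Fin 3 → Fin 2) : Set (GL (Fin 3) F))) → ρU u f ∈ (vanishingOn (standardParabolicGL F (id : Fin 3 → Fin 3)) (Representation.twist (((Representation.trivial ℂ (Π a : Fin 3, GL {i : Fin 3 // (id : Fin 3 → Fin 3) i = a} F) ℂ).twist χ).comp (leviProjection F (id : Fin 3 → Fin 3))) (rootDeltaChar (standardParabolicGL F (id : Fin 3 → Fin 3)))) (standardParabolicGL F (![0, 0, 1] : Fin 3 → Fin 2) : Set (GL (Fin 3) F))) := fun u f hf =>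
    smoothIndRep_mem_vanishingOn_of_mul_mem (![0, 0, 1] : Fin 3 → Fin 2) _ _ (parabolic_mul_mem (![0, 0, 1] : Fin 3 → Fin 2)) (unipotentRadicalGL_le F (![0, 0, 1] : Fin 3 → Fin 2) u.2) hf
  have hΦinv : ∀ (u : ↥(unipotentRadicalGL F (![0, 0, 1] : Fin 3 → Fin 2))) (f : (vanishingOn (standardParabolicGL F (id : Fin 3 → Fin 3)) (Representation.twist (((Representation.trivial ℂ (Π a : Fin 3, GL {i : Fin 3 // (id : Fin 3 → Fin 3) i = a} F) ℂ).twist χ).comp (leviProjection F (id : Fin 3 → Fin 3))) (rootDeltaChar (standardParabolicGL F (id : Fin 3 → Fin 3)))) (standardParabolicGL F (![0, 0, 1] : Fin 3 → Fin 2) : Set (GL (Fin 3) F)))), Φ ⟨ρU u f, hstabU u f.2⟩ = Φ f := fun u f =>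
    SmoothInd.ext (funext fun g => by
      rw [hΦ, hΦ]
      exact integral_middleCellFun_smoothIndRep_unipotentRadical μ χ e he (f : SmoothInd (standardParabolicGL F (id : Fin 3 → Fin 3)) (Representation.twist (((Representation.trivial ℂ (Π a : Fin 3, GL {i : Fin 3 // (id : Fin 3 → Fin 3) i = a} F) ℂ).twist χ).comp (leviProjection F (id : Fin 3 → Fin 3))) (rootDeltaChar (standardParabolicGL F (id : Fin 3 → Fin 3))))) (blockDiagonalGL_mem (![0, 0, 1] : Fin 3 → Fin 2) (ι g)) u.2)
  have hΦker : ∀ f : (vanishingOn (standardParabolicGL F (id : Fin 3 → Fin 3)) (Representation.twist (((Representation.trivial ℂ (Π a : Fin 3, GL {i : Fin 3 // (id : Fin 3 → Fin 3) i = a} F) ℂ).twist χ).comp (leviProjection F (id : Fin 3 → Fin 3))) (rootDeltaChar (standardParabolicGL F (id : Fin 3 → Fin 3)))) (standardParabolicGL F (![0, 0, 1] : Fin 3 → Fin 2) : Set (GL (Fin 3) F))), Representation.Coinvariants.mk (restrictUnipotentGL F (![0, 0, 1] : Fin 3 → Fin 2) (smoothIndRep (standardParabolicGL F (id : Fin 3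 → Fin 3)) (Representation.twist (((Representation.trivial ℂ (Π a : Fin 3, GL {i : Fin 3 // (id : Fin 3 → Fin 3) i = a} F) ℂ).twist χ).comp (leviProjection F (id : Fin 3 → Fin 3))) (rootDeltaChar (standardParabolicGL F (id : Fin 3 → Fin 3)))))) (f : SmoothInd (standardParabolicGL F (id : Fin 3 → Fin 3)) (Representation.twist (((Representation.trivial ℂ (Π a : Fin 3, GL {i : Fin 3 // (id : Fin 3 → Fin 3) i = a} F) ℂ).twist χ).comp (leviProjection F (id : Fin 3 → Fin 3))) (rootDeltaChar (standardParabolicGL F (id : Fin 3 → Fin 3))))) = 0 → Φ f = 0 := fun f hf => by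
    have hf' : Representation.Coinvariants.mk ρU (f : SmoothInd (standardParabolicGL F (id : Fin 3 → Fin 3)) (Representation.twist (((Representation.trivial ℂ (Π a : Fin 3, GL {i : Fin 3 // (id : Fin 3 → Fin 3) i = a} F) ℂ).twist χ).comp (leviProjection F (id : Fin 3 → Fin 3))) (rootDeltaChar (standardParabolicGL F (id : Fin 3 → Fin 3))))) = 0 := by
      rw [Representation.Coinvariants.mk_eq_zero] at hf ⊢
      rw [ker_restrictUnipotentGL_eq (![0, 0, 1] : Fin 3 → Fin 2) (smoothIndRep (standardParabolicGL F (id : Fin 3 → Fin 3)) (Representation.twist (((Representation.trivial ℂ (Π a : Fin 3, GL {i : Fin 3 // (id : Fin 3 → Fin 3) i = a} F) ℂ).twist χ).comp (leviProjection F (id : Fin 3 → Fin 3))) (rootDeltaChar (standardParabolicGL F (id : Fin 3 → Fin 3)))))] at hf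
      exact hf
    exact apply_eq_zero_of_mk_coinvariants_eq_zero (isLimitOfCompactOpen_unipotentRadicalGL F (![0, 0, 1] : Fin 3 → Fin 2) K2E3GL3MaximalParabolicRelabel.monotone_twoOne)
      hρU _ hstabU Φ hΦinv f hf'
  let φ : (vanishingOn (standardParabolicGL F (id : Fin 3 → Fin 3)) (Representation.twist (((Representation.trivial ℂ (Π a : Fin 3, GL {i : Fin 3 // (id : Fin 3 → Fin 3) i = a} F) ℂ).twist χ).comp (leviProjection F (id : Fin 3 → Fin 3))) (rootDeltaChar (standardParabolicGL F (id : Fin 3 → Fin 3)))) (standardParabolicGL F (![0, 0, 1] : Fin 3 → Fin 2) : Set (GL (Fin 3) F))) →ₗ[ℂ] (restrictUnipotentGL F (![0, 0, 1] : Fin 3 → Fin 2) (smoothIndRep (standardParabolicGL F (id : Fin 3 → Fin 3)) (Representation.twist (((Representation.trivial ℂ (Π a : Fin 3, GL {i : Fin 3 // (id : Fin 3 → Fin 3) i = a} F) ℂ).twist χ).comp (leviProjection F (id : Fin 3 → Fin 3))) (rootDeltaChar (standardParabolicGL F (id : Fin 3 → Fin 3)))))).Coinvariants := (Representation.Coinvariants.mk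 (restrictUnipotentGL F (![0, 0, 1] : Fin 3 → Fin 2) (smoothIndRep (standardParabolicGL F (id : Fin 3 → Fin 3)) (Representation.twist (((Representation.trivial ℂ (Π a : Fin 3, GL {i : Fin 3 // (id : Fin 3 → Fin 3) i = a} F) ℂ).twist χ).comp (leviProjection F (id : Fin 3 → Fin 3))) (rootDeltaChar (standardParabolicGL F (id : Fin 3 → Fin 3))))))) ∘ₗ (vanishingOn (standardParabolicGL F (id : Fin 3 → Fin 3)) (Representation.twist (((Representation.trivial ℂ (Π a : Fin 3, GL {i : Fin 3 // (id : Fin 3 → Fin 3) i = a} F) ℂ).twist χ).comp (leviProjection F (id : Fin 3 → Fin 3))) (rootDeltaChar (standardParabolicGL F (id : Fin 3 → Fin 3)))) (standardParabolicGL F (![0, 0, 1] : Fin 3 → Fin 2) : Set (GL (Fin 3) F))).subtype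
  have hφ : ∀ f : (vanishingOn (standardParabolicGL F (id : Fin 3 → Fin 3)) (Representation.twist (((Representation.trivial ℂ (Π a : Fin 3, GL {i : Fin 3 // (id : Fin 3 → Fin 3) i = a} F) ℂ).twist χ).comp (leviProjection F (id : Fin 3 → Fin 3))) (rootDeltaChar (standardParabolicGL F (id : Fin 3 → Fin 3)))) (standardParabolicGL F (![0, 0, 1] : Fin 3 → Fin 2) : Set (GL (Fin 3) F))), φ f = Representation.Coinvariants.mk (restrictUnipotentGL F (![0, 0, 1] : Fin 3 → Fin 2) (smoothIndRep (standardParabolicGL F (id : Fin 3 → Fin 3)) (Representation.twist (((Representation.trivial ℂ (Π a : Fin 3, GL {i : Fin 3 // (id : Fin 3 → Fin 3) i = a} F) ℂ).twist χ).comp (leviProjection F (id : Fin 3 → Fin 3))) (rootDeltaChar (standardParabolicGL F (id : Fin 3 → Fin 3)))))) (f : SmoothInd (standardParabolicGL F (id : Fin 3 → Fin 3)) (Representation.twist (((Representation.trivial ℂ (Π a : Fin 3, GL {i : Fin 3 // (id : Fin 3 → Fin 3) i = a} F) ℂ).twist χ).comp (leviProjection F (id : Fin 3 → Fin 3))) (rootDeltaChar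 (standardParabolicGL F (id : Fin 3 → Fin 3))))) := fun f => rfl
  have hkerφ : LinearMap.ker φ ≤ LinearMap.ker Φ := fun f hf => by
    rw [LinearMap.mem_ker] at hf ⊢
    exact hΦker f hf
  have hrange : LinearMap.range φ = J₁.toSubmodule := by
    refine le_antisymm ?_ fun x hx => ?_
    · rintro _ ⟨f, rfl⟩
      exact (hJ₁ _).2 ⟨f, f.2, rfl⟩
    · obtain ⟨f, hf, rfl⟩ := (hJ₁ x).1 hx
      exact ⟨⟨f, hf⟩, rfl⟩
  let Ψ : J₁.toSubmodule →ₗ[ℂ] SmoothInd (standardParabolicGL F (id : Fin 2 → Fin 2)) (Representation.twist (((Representation.trivial ℂ (Π a : Fin 2, GL {i : Fin 2 // (id : Fin 2 → Fin 2) i = a} F) ℂ).twist χ₂).comp (leviProjection F (id : Fin 2 → Fin 2))) (rootDeltaChar (standardParabolicGL F (id : Fin 2 → Fin 2)))) :=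
    ((LinearMap.ker φ).liftQ Φ hkerφ) ∘ₗ (φ.quotKerEquivRange.symm : ↥(LinearMap.range φ) →ₗ[ℂ] ((vanishingOn (standardParabolicGL F (id : Fin 3 → Fin 3)) (Representation.twist (((Representation.trivial ℂ (Π a : Fin 3, GL {i : Fin 3 // (id : Fin 3 → Fin 3) i = a} F) ℂ).twist χ).comp (leviProjection F (id : Fin 3 → Fin 3))) (rootDeltaChar (standardParabolicGL F (id : Fin 3 → Fin 3)))) (standardParabolicGL F (![0, 0, 1] : Fin 3 → Fin 2) : Set (GL (Fin 3) F))) ⧸ LinearMap.ker φ)) ∘ₗ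
      ((LinearEquiv.ofEq _ _ hrange.symm : ↥J₁.toSubmodule ≃ₗ[ℂ] ↥(LinearMap.range φ)) : ↥J₁.toSubmodule →ₗ[ℂ] ↥(LinearMap.range φ))
  have hΨφ : ∀ (f : (vanishingOn (standardParabolicGL F (id : Fin 3 → Fin 3)) (Representation.twist (((Representation.trivial ℂ (Π a : Fin 3, GL {i : Fin 3 // (id : Fin 3 → Fin 3) i = a} F) ℂ).twist χ).comp (leviProjection F (id : Fin 3 → Fin 3))) (rootDeltaChar (standardParabolicGL F (id : Fin 3 → Fin 3)))) (standardParabolicGL F (![0, 0, 1] : Fin 3 → Fin 2) : Set (GL (Fin 3) F)))) (h : φ f ∈ J₁.toSubmodule), Ψ ⟨φ f, h⟩ = Φ f := fun f h => by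
    change (LinearMap.ker φ).liftQ Φ hkerφ (φ.quotKerEquivRange.symm ⟨φ f, LinearMap.mem_range_self φ f⟩) = Φ f
    rw [LinearMap.quotKerEquivRange_symm_apply_image, Submodule.mkQ_apply, Submodule.liftQ_apply]
  refine ⟨χ₂, Ψ, fun f hf g => ?_, fun g a => ?_⟩
  · -- value formula
    have h := hΨφ ⟨f, hf⟩ ((hJ₁ _).2 ⟨f, hf, rfl⟩)
    exact (congrArg (fun x : SmoothInd (standardParabolicGL F (id : Fin 2 → Fin 2)) (Representation.twist (((Representation.trivial ℂ (Π a : Fin 2, GL {i : Fin 2 // (id : Fin 2 → Fin 2) i = a} F) ℂ).twist χ₂).comp (leviProjection F (id : Fin 2 → Fin 2))) (rootDeltaChar (standardParabolicGL F (id : Fin 2 → Fin 2)))) => x.toFun g) h).trans (hΦ _ _)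
  · -- equivariance
    obtain ⟨f, hf, hfa⟩ := (hJ₁ (a : (restrictUnipotentGL F (![0, 0, 1] : Fin 3 → Fin 2) (smoothIndRep (standardParabolicGL F (id : Fin 3 → Fin 3)) (Representation.twist (((Representation.trivial ℂ (Π a : Fin 3, GL {i : Fin 3 // (id : Fin 3 → Fin 3) i = a} F) ℂ).twist χ).comp (leviProjection F (id : Fin 3 → Fin 3))) (rootDeltaChar (standardParabolicGL F (id : Fin 3 → Fin 3)))))).Coinvariants)).1 a.2
    have hf' : (smoothIndRep (standardParabolicGL F (id : Fin 3 → Fin 3)) (Representation.twist (((Representation.trivial ℂ (Π a : Fin 3, GL {i : Fin 3 // (id : Fin 3 → Fin 3) i = a} F) ℂ).twist χ).comp (leviProjection F (id : Fin 3 → Fin 3))) (rootDeltaChar (standardParabolicGL F (id : Fin 3 → Fin 3))))) (((blockDiagonalGL F (![0, 0, 1] : Fin 3 → Fin 2)) (ι g) : GL (Fin 3) F)) f ∈ (vanishingOn (standardParabolicGL F (id : Fin 3 → Fin 3)) (Representation.twist (((Representation.trivial ℂ (Π a : Fin 3, GL {i : Fin 3 // (id : Fin 3 → Fin 3) i = a}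 F) ℂ).twist χ).comp (leviProjection F (id : Fin 3 → Fin 3))) (rootDeltaChar (standardParabolicGL F (id : Fin 3 → Fin 3)))) (standardParabolicGL F (![0, 0, 1] : Fin 3 → Fin 2) : Set (GL (Fin 3) F))) :=
      smoothIndRep_mem_vanishingOn_of_mul_mem (![0, 0, 1] : Fin 3 → Fin 2) _ _ (parabolic_mul_mem (![0, 0, 1] : Fin 3 → Fin 2)) (blockDiagonalGL_mem (![0, 0, 1] : Fin 3 → Fin 2) (ι g)) hf
    have ha : a = ⟨φ ⟨f, hf⟩, (hJ₁ _).2 ⟨f, hf, rfl⟩⟩ := Subtype.ext hfa.symm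
    have hga : J₁.toRepresentation (ι g) a = ⟨φ ⟨_, hf'⟩, (hJ₁ _).2 ⟨_, hf', rfl⟩⟩ := by
      refine Subtype.ext ?_
      rw [ha]
      change (jacquetGL F (![0, 0, 1] : Fin 3 → Fin 2) (smoothIndRep (standardParabolicGL F (id : Fin 3 → Fin 3)) (Representation.twist (((Representation.trivial ℂ (Π a : Fin 3, GL {i : Fin 3 // (id : Fin 3 → Fin 3) i = a} F) ℂ).twist χ).comp (leviProjection F (id : Fin 3 → Fin 3))) (rootDeltaChar (standardParabolicGL F (id : Fin 3 → Fin 3)))))) (ι g) (Representation.Coinvariants.mk (restrictUnipotentGL F (![0, 0, 1] : Fin 3 → Fin 2) (smoothIndRep (standardParabolicGL F (id : Fin 3 → Fin 3)) (Representation.twist (((Representation.trivial ℂ (Π a : Fin 3, GL {i : Fin 3 // (id : Fin 3 → Fin 3) i = a} F) ℂ).twist χ).comp (leviProjection F (id : Fin 3 → Fin 3))) (rootDeltaChar (standardParabolicGL F (id : Fin 3 → Fin 3)))))) f) = Representation.Coinvariants.mk (restrictUnipotentGL F (![0, 0, 1] : Fin 3 → Fin 2) (smoothIndRep (standardParabolicGL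 F (id : Fin 3 → Fin 3)) (Representation.twist (((Representation.trivial ℂ (Π a : Fin 3, GL {i : Fin 3 // (id : Fin 3 → Fin 3) i = a} F) ℂ).twist χ).comp (leviProjection F (id : Fin 3 → Fin 3))) (rootDeltaChar (standardParabolicGL F (id : Fin 3 → Fin 3)))))) ((smoothIndRep (standardParabolicGL F (id : Fin 3 → Fin 3)) (Representation.twist (((Representation.trivial ℂ (Π a : Fin 3, GL {i : Fin 3 // (id : Fin 3 → Fin 3) i = a} F) ℂ).twist χ).comp (leviProjection F (id : Fin 3 → Fin 3))) (rootDeltaChar (standardParabolicGL F (id : Fin 3 → Fin 3))))) (((blockDiagonalGL F (![0, 0, 1] : Fin 3 → Fin 2)) (ι g) : GL (Fin 3) F)) f)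
      rw [jacquetGL_mk]
    rw [hga, hΨφ, ha, hΨφ]
    refine SmoothInd.ext (funext fun g' => ?_)
    change (Φ ⟨_, hf'⟩).toFun g' = (smoothIndRep (standardParabolicGL F (id : Fin 2 → Fin 2)) (Representation.twist (((Representation.trivial ℂ (Π a : Fin 2, GL {i : Fin 2 // (id : Fin 2 → Fin 2) i = a} F) ℂ).twist χ₂).comp (leviProjection F (id : Fin 2 → Fin 2))) (rootDeltaChar (standardParabolicGL F (id : Fin 2 → Fin 2)))) g (Φ ⟨f, hf⟩)).toFun g'
    rw [hΦ, toFun_smoothIndRep_apply, hΦ, map_mul, map_mul]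
    simp only [toFun_smoothIndRep_apply, mul_assoc]

end Map

end Summit.HodgeConjecture.HodgeConjecture.Cruxes.H413.K2E3GL3BorelInducedJacquetQMiddleCellMap

end
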